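import Mathlib

/-!
# Crux `MonotoneSuffices` (stmt-PneNP-18026), the GREEDY general detector — part 7:
# a hypergeometric tail by double counting

For a fixed vertex set `W` (the `≤ tM` candidates of one trial) a uniformly random `k`-set `A` rarely meets `W`
in `s` or more vertices:

* `card_supset_le` — the `k`-sets containing a fixed `s`-set `S` number at most `C(n-s, k-s)`;
* `card_filter_le_inter_mul_choose_le` — `#{A : #A = k, s ≤ #(A ∩ W)} · C(n,s) ≤ C(n,k) · C(#W,s) · C(k,s)`
  (each such `A` contains an `s`-subset of `W`; `C(n,s) C(n-s,k-s) = C(n,k) C(k,s)`), i.e. the fraction of bad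
  `A` is at most `C(#W,s) C(k,s)/C(n,s) ≤ (#W k/(n+1-s))^s/s!`.

Pure finite combinatorics.
-/

set_option linter.dupNamespace false -- `Summit.PneNP.PneNP.…`: summit = sub-problem name (D-0017 single-conjunct layout)

namespace Summit.PneNP.PneNP.Theorems.MonotoneSuffices.Greedy

open Finset

variable {n : ℕ}

/-- The `k`-subsets of the vertex set containing a fixed `s`-set `S` number at most `C(n-s, k-s)`. [folklore] -/
theorem card_supset_le (S : Finset (Fin n)) (k : ℕ) :
    #((powersetCard k (univ : Finset (Fin n))).filter fun A => S ⊆ A) ≤ (n - #S).choose (k - #S) := by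
  classical
  have htarget : #(powersetCard (k - #S) ((univ : Finset (Fin n)) \ S)) = (n - #S).choose (k - #S) := by
    rw [card_powersetCard, card_univ_sdiff, Fintype.card_fin]
  rw [← htarget]
  refine card_le_card_of_injOn (fun A => A \ S) (fun A hA => ?_) (fun A₁ hA₁ A₂ hA₂ h => ?_)
  · rw [mem_coe, mem_filter, mem_powersetCard] at hA
    obtain ⟨⟨-, hAk⟩, hSA⟩ := hA
    rw [mem_coe, mem_powersetCard]
    exact ⟨sdiff_subset_sdiff (subset_univ _) subset_rfl, by rw [card_sdiff_of_subset hSA, hAk]⟩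
  · rw [mem_coe, mem_filter] at hA₁ hA₂
    have h0 : A₁ \ S = A₂ \ S := h
    have h' : A₁ \ S ∪ S = A₂ \ S ∪ S := by rw [h0]
    rwa [sdiff_union_of_subset hA₁.2, sdiff_union_of_subset hA₂.2] at h'

/-- **Hypergeometric tail by double counting.** For `s ≤ k`:
`#{A : #A = k, s ≤ #(A ∩ W)} · C(n,s) ≤ C(n,k) · (C(#W,s) · C(k,s))`. [folklore] -/
theorem card_filter_le_inter_mul_choose_le (W : Finset (Fin n)) {k s : ℕ} (hs : s ≤ k) :
    #((powersetCard k (univ : Finset (Fin n))).filter fun A => s ≤ #(A ∩ W)) * n.choose s ≤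
      n.choose k * ((#W).choose s * k.choose s) := by
  classical
  -- each bad `A` contains an `s`-subset of `W`
  have hsub : ((powersetCard k (univ : Finset (Fin n))).filter fun A => s ≤ #(A ∩ W)) ⊆
      (powersetCard s W).biUnion fun S => (powersetCard k (univ : Finset (Fin n))).filter fun A => S ⊆ A := by
    intro A hA
    rw [mem_filter] at hA
    obtain ⟨S, hS, hScard⟩ := exists_subset_card_eq hA.2
    rw [mem_biUnion]
    refine ⟨S, mem_powersetCard.2 ⟨hS.trans inter_subset_right, hScard⟩, mem_filter.2 ⟨hA.1, hS.trans inter_subset_left⟩⟩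
  have h1 : #((powersetCard k (univ : Finset (Fin n))).filter fun A => s ≤ #(A ∩ W)) ≤
      (#W).choose s * (n - s).choose (k - s) := by
    refine ((card_le_card hsub).trans card_biUnion_le).trans ?_
    calc ∑ S ∈ powersetCard s W, #((powersetCard k (univ : Finset (Fin n))).filter fun A => S ⊆ A)
        ≤ ∑ S ∈ powersetCard s W, (n - s).choose (k - s) := sum_le_sum fun S hS => by
          have := card_supset_le S k
          rwa [(mem_powersetCard.1 hS).2] at this
      _ = (#W).choose s * (n - s).choose (k - s) := by rw [sum_const, smul_eq_mul, card_powersetCard]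
  calc #((powersetCard k (univ : Finset (Fin n))).filter fun A => s ≤ #(A ∩ W)) * n.choose s
      ≤ (#W).choose s * (n - s).choose (k - s) * n.choose s := Nat.mul_le_mul_right _ h1
    _ = (#W).choose s * (n.choose s * (n - s).choose (k - s)) := by ring
    _ = (#W).choose s * (n.choose k * k.choose s) := by rw [Nat.choose_mul hs]
    _ = n.choose k * ((#W).choose s * k.choose s) := by ring

end Summit.PneNP.PneNP.Theorems.MonotoneSuffices.Greedy

namespace Summit.PneNP.PneNP.Theorems.MonotoneSuffices.Greedy

open Finset

/-- Registered sub-goal `greedy_hyper` of stmt-PneNP-18026 (greedy detector, part 7): the hypergeometric tail by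
double counting, exported verbatim. [folklore] -/
theorem greedy_hyper :
    ∀ {n : ℕ} (W : Finset (Fin n)) {k s : ℕ}, s ≤ k → #((Finset.powersetCard k (Finset.univ : Finset (Fin n))).filter fun A => s ≤ #(A ∩ W)) * n.choose s ≤ n.choose k * ((#W).choose s * k.choose s) :=
  fun W _ _ hs => card_filter_le_inter_mul_choose_le W hs

end Summit.PneNP.PneNP.Theorems.MonotoneSuffices.Greedy
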